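import Summits.QuantumFields.GaugeBoot.SymmetrizedMasterLoopUniqueness
import Summits.QuantumFields.GaugeBoot.SOMasterLoopEquation
import Literature.MathematicalPhysics.QuantumFieldTheory.Chatterjee2019LargeN.SymmetrizedLimitEquation
import Literature.MathematicalPhysics.QuantumFieldTheory.Chatterjee2019LargeN.WilsonLoopFactorization
import Literature.MathematicalPhysics.QuantumFieldTheory.Chatterjee2019LargeN.CoeffRecursionFromDuality
import Literature.MathematicalPhysics.QuantumFieldTheory.Chatterjee2019LargeN.RealAnalyticity
import Literature.MathematicalPhysics.QuantumFieldTheory.Chatterjee2019LargeN.AreaLawPerimeter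
import HarnessLib

/-!
# CHATTERJEE'S THEOREM 3.1 — gauge–string duality of `SO(N)` lattice gauge theory in the 't Hooft limit at strong coupling — PROVED (gauge-boot, ADDENDUM 28 part D)

HONEST FRAMING (cell `pub-gaugeboot`, page 1 of every file): the venture produces certified bounds
on lattice expectations at stated coupling, gauge group, dimension and torus size; NOT a mass gap,
NOT a continuum limit, NOT a string tension; NOT Yang–Mills-summit-bearing (barriers
`FixedCouplingUltralocality`, `PerturbativeInvisibility`).  This file DISCHARGES the central named fact of the tree's
`Chatterjee2019LargeN` directory; the statement concerns the STRONG-COUPLING LARGE-`N` limit of `SO(N)` lattice gauge theory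
with free boundary condition in `ℤ^d`, `d ≥ 2`, and says nothing about four-dimensional continuum Yang–Mills or a mass gap.

## Content

★★★ `gaugeStringDuality_holds : GaugeStringDuality d` — S. Chatterjee, *Rigorous solution of strongly coupled `SO(N)`
lattice gauge theory in the large `N` limit*, Comm. Math. Phys. **366** (2019) 203–268, **THEOREM 3.1 (main result)**:
there is `β₀(d) > 0` such that for every exhaustion `Λ_N ↑ ℤ^d`, every `|β| ≤ β₀(d)` and every loop sequence `s` with
minimal representation `(l₁, …, lₙ)`,

  `lim_{N→∞} ⟨W_{l₁} W_{l₂} ⋯ W_{lₙ}⟩_{Λ_N,N,β} / Nⁿ = Σ_{X ∈ 𝒳(s)} w_β(X)`,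

the sum over all vanishing string trajectories of `s` in Chatterjee's lattice string theory, absolutely convergent.

PROOF (the lane's route, shorter than the source's §§10–12): by ADDENDUM 27 (`SOMasterLoop.thooftLimit_holds`,
`SOMasterLoop.symmetrizedLimitMasterLoopEquation_holds` = Theorems 9.2 and 9.9, unconditional since Theorem 8.1 was
proved there) the 't Hooft limit `φ(s) = lim_N φ_{Λ_N,N,β}(s)` exists for small `|β|`, is bounded by `1`, equals `1` at
`∅`, and satisfies the SYMMETRIZED limiting master loop equation; by the tree's Theorem 11.1
(`CoeffCatalanBoundProof.trajectoryWeight_summable`, `absCoeff_mul_pow_le`) the trajectory sum `T(s) = Σ_X w_β(X)` is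
absolutely convergent with `|T(s)| ≤ 2 K^{ι(s)} Π(s) ≤ 2 (4K)^{|s|}` (`trajectorySum_summable_and_abs_le`), equals `1` at
`∅`, and satisfies the same symmetrized equation by the first-move decomposition of trajectories (the tree's
`tsum_weight_eq_sum_moves`; `trajectorySum_equation`).  The sibling `SymmetrizedMasterLoopUniqueness.symmetrized_unique`
(Catalan-weighted sup-norm contraction) gives `φ = T`.  The source instead identifies `φ` with a power series whose
coefficients are defined by the marked recursion (Lemma 10.1, Theorem 10.3, Corollary 10.4, §12); that detour is not
needed.

CONSEQUENCES, now unconditional (one-liners over the tree's `_of_gaugeStringDuality` theorems): ★★★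
`wilsonLoopFactorization_holds` (Corollary 3.2: FACTORIZATION OF WILSON LOOPS, `lim ⟨W_{l₁}⋯W_{lₙ}⟩/Nⁿ = Π lim ⟨W_{lᵢ}⟩/N`),
★★★ `realAnalyticityStrongCoupling_holds` (Corollary 3.5: `lim ⟨W_{l₁}⋯⟩/Nⁿ = Σ_k a_k(s) β^k`, real analyticity at strong
coupling), ★★ `coeffRecursion_holds` (Proposition 4.1, the algorithm for the coefficients), `areaLawUpperBound_loopwise`
/ `areaLawUpperBound_perimeter` (Corollary 3.3 in the tree's loopwise and perimeter forms), and the existence half of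
Theorem 9.2 in the form «the trajectory sum is a class-1 solution of the marked master loop equation»
(`isMasterLoopSolution_trajectorySum`).  NOT claimed: Corollary 3.4 (`LimitingPartitionFunction`, §15) and the named
fact `AreaLawUpperBound` in its perimeter-free printed form.

Everything is `[folklore]` given the source.
-/

noncomputable section

open Finset Filter Topology
open Literature.MathematicalPhysics.QuantumFieldTheory.Chatterjee2019LargeN
open Literature.MathematicalPhysics.QuantumFieldTheory.Chatterjee2019LargeN.CoeffCatalanBoundProof

namespace Summit.QuantumFields.GaugeBoot

namespace StringDuality

variable {d : ℕ}

/-! ## The trajectory sum `T(s) = Σ_{X ∈ 𝒳(s)} w_β(X)`: bound and symmetrized equation -/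

/-- `Π(s) = C_{|l₁|−1} ⋯ C_{|lₙ|−1} ≤ 4^{|s|}` (`C_j ≤ 4^j`). [cite: Chatterjee2019LargeN, §10 (inequality (catalan2): C_{i+1} ≤ 4 C_i)] -/
theorem catProd_le_four_pow : ∀ s : LoopSeq d, catProd s ≤ 4 ^ s.len
  | [] => by simp [LoopSeq.len_nil]
  | l :: s => by
    rw [catProd_cons, LoopSeq.len_cons, pow_add]
    have h1 : (catalan (l.length - 1) : ℝ) ≤ 4 ^ l.length := by
      have h := catalan_add_le 0 (l.length - 1)
      rw [zero_add, catalan_zero, mul_one] at h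
      calc (catalan (l.length - 1) : ℝ) ≤ (4 : ℝ) ^ (l.length - 1) := by exact_mod_cast h
        _ ≤ 4 ^ l.length := pow_le_pow_right₀ (by norm_num) (Nat.sub_le _ _)
    exact mul_le_mul h1 (catProd_le_four_pow s) (catProd_nonneg s) (by positivity)

/-- **Theorem 11.1 with the bound made explicit**: for `|β| ≤ 1/(2K⁵)` (`K = K(d)` of Lemma 10.1) and a genuine loop
sequence `s`, `X ↦ w_β(X)` is summable over `𝒳(s)` and `|Σ_X w_β(X)| ≤ Σ_X |w_β(X)| ≤ 2 K^{ι(s)} Π(s) ≤ 2 (4K)^{|s|}`.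
[cite: Chatterjee2019LargeN, Theorem 11.1 and its proof (Lemmas 11.2–11.4); Theorem 10.3 (the bound (4K)^{|s|})] -/
theorem trajectorySum_summable_and_abs_le {β : ℝ} (hβ : |β| ≤ 1 / (2 * bigK d ^ 5)) {s : LoopSeq d}
    (hs : IsLoopSeq s) :
    Summable (fun X : Trajectory s => X.weight β) ∧
      |∑' X : Trajectory s, X.weight β| ≤ 2 * (4 * bigK d) ^ s.len := by
  have hK1 : 1 ≤ bigK d := one_le_bigK d
  -- the fibres `𝒳ₖ(s)` and their sums
  have hfib : ∀ k : ℕ, HasSum (fun X : TrajectoryWith s k => |X.1.weight β|) (absCoeff s k * |β| ^ k) := by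
    intro k
    haveI : Fintype (TrajectoryWith s k) := @Fintype.ofFinite _ (finite_trajectoryWith s k)
    have h := (hasSum_fintype (fun X : TrajectoryWith s k => |X.1.weight β|)).summable.hasSum
    rwa [tsum_abs_weight_trajectoryWith s β k] at h
  have hle : ∀ k : ℕ, absCoeff s k * |β| ^ k ≤ bigK d ^ s.index * catProd s * (1 / 2) ^ k := fun k =>
    absCoeff_mul_pow_le hβ hs k
  have hgeo : HasSum (fun k : ℕ => bigK d ^ s.index * catProd s * ((1 : ℝ) / 2) ^ k)
      (bigK d ^ s.index * catProd s * 2) :=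
    hasSum_geometric_two.mul_left (bigK d ^ s.index * catProd s)
  -- absolute summability over `𝒳(s) = ⨆ₖ 𝒳ₖ(s)`
  let e := Equiv.sigmaFiberEquiv fun X : Trajectory s => X.numDeform
  have habs : Summable (fun X : Trajectory s => |X.weight β|) := by
    refine (e.summable_iff (f := fun X : Trajectory s => |X.weight β|)).mp ?_
    refine (summable_sigma_of_nonneg fun _ => abs_nonneg _).2 ⟨fun k => (hfib k).summable, ?_⟩
    refine Summable.of_nonneg_of_le (fun k => tsum_nonneg fun _ => abs_nonneg _) (fun k => ?_) hgeo.summable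
    calc ∑' X : TrajectoryWith s k, |X.1.weight β| = absCoeff s k * |β| ^ k := tsum_abs_weight_trajectoryWith s β k
      _ ≤ bigK d ^ s.index * catProd s * (1 / 2) ^ k := hle k
  refine ⟨summable_abs_iff.mp habs, ?_⟩
  -- the bound
  have hsig : HasSum (fun p : Σ k : ℕ, TrajectoryWith s k => |p.2.1.weight β|) (∑' X : Trajectory s, |X.weight β|) :=
    (e.hasSum_iff (f := fun X : Trajectory s => |X.weight β|)).mpr habs.hasSum
  have hk : HasSum (fun k : ℕ => absCoeff s k * |β| ^ k) (∑' X : Trajectory s, |X.weight β|) :=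
    hsig.sigma fun k => hfib k
  have h1 : ∑' X : Trajectory s, |X.weight β| ≤ bigK d ^ s.index * catProd s * 2 := hasSum_le hle hk hgeo
  have h2 : |∑' X : Trajectory s, X.weight β| ≤ ∑' X : Trajectory s, |X.weight β| := by
    have h := norm_tsum_le_tsum_norm (f := fun X : Trajectory s => X.weight β)
      (by simpa only [Real.norm_eq_abs] using habs)
    simpa only [Real.norm_eq_abs] using h
  have h3 : bigK d ^ s.index * catProd s ≤ (4 * bigK d) ^ s.len := by
    calc bigK d ^ s.index * catProd s ≤ bigK d ^ s.len * 4 ^ s.len :=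
          mul_le_mul (pow_le_pow_right₀ hK1 (Nat.sub_le _ _)) (catProd_le_four_pow s) (catProd_nonneg s)
            (by positivity)
      _ = (4 * bigK d) ^ s.len := by rw [mul_pow, mul_comm]
  calc |∑' X : Trajectory s, X.weight β| ≤ bigK d ^ s.index * catProd s * 2 := h2.trans h1
    _ ≤ (4 * bigK d) ^ s.len * 2 := mul_le_mul_of_nonneg_right h3 (by norm_num)
    _ = 2 * (4 * bigK d) ^ s.len := by ring

/-- **The trajectory sum satisfies the symmetrized limiting master loop equation** (first-move decomposition of
vanishing trajectories, with the move weights `∓β/|s|`, `∓1/|s|`): for a genuine non-null `s` and `|β| ≤ 1/(2K⁵)`,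
`|s| T(s) = Σ_{𝕊⁻(s)} T − Σ_{𝕊⁺(s)} T + β Σ_{𝔻⁻(s)} T − β Σ_{𝔻⁺(s)} T`.
[cite: Chatterjee2019LargeN, §2.2 (trajectories and weights), Theorem 9.9 (the display); §12] -/
theorem trajectorySum_equation {β : ℝ} (hβ : |β| ≤ 1 / (2 * bigK d ^ 5)) {s : LoopSeq d} (hs : IsLoopSeq s)
    (hne : s ≠ []) :
    (s.len : ℝ) * (∑' X : Trajectory s, X.weight β) =
      (∑ o : InvIdx s, ∑' X : Trajectory (s.negSplitAt o), X.weight β)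
        - (∑ o : SameIdx s, ∑' X : Trajectory (s.posSplitAt o), X.weight β)
        + β * (∑ o : DeformIdx s, ∑' X : Trajectory (s.negDeformAt o), X.weight β)
        - β * (∑ o : DeformIdx s, ∑' X : Trajectory (s.posDeformAt o), X.weight β) := by
  classical
  set T : LoopSeq d → ℝ := fun t => ∑' X : Trajectory t, X.weight β with hT
  have hsumm : ∀ t : LoopSeq d, IsLoopSeq t → Summable fun X : Trajectory t => X.weight β := fun t ht =>
    (trajectorySum_summable_and_abs_le hβ ht).1
  letI : Fintype (Literature.MathematicalPhysics.QuantumFieldTheory.Chatterjee2019LargeN.Move s) := Fintype.ofEquiv _ (Move.equivSum (s := s)).symm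
  have h1 : T s = ∑ m : Literature.MathematicalPhysics.QuantumFieldTheory.Chatterjee2019LargeN.Move s, m.weight β * T m.result := by
    have h := tsum_weight_eq_sum_moves hne β (hsumm s hs) fun m => hsumm _ (hs.moveResult m)
    exact (h.unique (hasSum_fintype _)).symm ▸ rfl
  have h2 : ∑ m : Literature.MathematicalPhysics.QuantumFieldTheory.Chatterjee2019LargeN.Move s, m.weight β * T m.result =
      ((∑ o : DeformIdx s, (-β / (s.len : ℝ)) * T (s.posDeformAt o)) +
        ∑ o : DeformIdx s, (β / (s.len : ℝ)) * T (s.negDeformAt o)) +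
      ((∑ o : SameIdx s, (-1 / (s.len : ℝ)) * T (s.posSplitAt o)) +
        ∑ o : InvIdx s, (1 / (s.len : ℝ)) * T (s.negSplitAt o)) := by
    rw [← (Move.equivSum (s := s)).symm.sum_comp, Fintype.sum_sum_type, Fintype.sum_sum_type, Fintype.sum_sum_type]
    rfl
  have hlen : (s.len : ℝ) ≠ 0 := by exact_mod_cast (LoopSeq.len_pos hs hne).ne'
  change (s.len : ℝ) * T s =
    (∑ o : InvIdx s, T (s.negSplitAt o)) - (∑ o : SameIdx s, T (s.posSplitAt o))
      + β * (∑ o : DeformIdx s, T (s.negDeformAt o)) - β * (∑ o : DeformIdx s, T (s.posDeformAt o))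
  rw [h1, h2]
  simp only [← Finset.mul_sum]
  field_simp
  ring

/-- `Σ_{X ∈ 𝒳(∅)} w_β(X) = 1` (the trivial trajectory). [cite: Chatterjee2019LargeN, §2.2 («If s = ∅, then 𝒳(s) consists of only one trajectory»), Theorem 3.1 (null case)] -/
theorem trajectorySum_nil (β : ℝ) : ∑' X : Trajectory ([] : LoopSeq d), X.weight β = 1 := by
  rw [tsum_eq_single Trajectory.nil (fun X hX => (hX (trajectory_nil_eq_nil X)).elim)]
  rfl

/-! ## Theorem 3.1 -/

variable (d)

/-- ★★★ **CHATTERJEE'S THEOREM 3.1 (gauge–string duality in the 't Hooft limit at strong coupling), PROVED** — the tree's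
named fact `GaugeStringDuality`: there is `β₀(d) > 0` such that for every exhaustion `Λ_N ↑ ℤ^d` of `ℤ^d` (`d ≥ 2`),
every `|β| ≤ β₀(d)` and every loop sequence `s = (l₁, …, lₙ)` in minimal representation, the family of trajectory weights
`X ↦ w_β(X)` on the vanishing trajectories `𝒳(s)` is absolutely summable and
`⟨W_{l₁} ⋯ W_{lₙ}⟩_{Λ_N,N,β} / Nⁿ → Σ_{X ∈ 𝒳(s)} w_β(X)` as `N → ∞`.  Proof: the 't Hooft limit (Theorem 9.2) and the
trajectory sum (Theorem 11.1) both solve the symmetrized limiting master loop equation (Theorem 9.9 / first-move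
decomposition) in the class `|f(s)| ≤ 2(4K)^{|s|}`, where the solution is unique (`symmetrized_unique`).
[cite: Chatterjee2019LargeN, Theorem 3.1] -/
theorem gaugeStringDuality_holds : GaugeStringDuality d := by
  intro hd
  obtain ⟨β₁, hβ₁, H1⟩ := SOMasterLoop.thooftLimit_holds d hd
  obtain ⟨β₂, hβ₂, H2⟩ := SOMasterLoop.symmetrizedLimitMasterLoopEquation_holds d hd
  have hK1 : 1 ≤ bigK d := one_le_bigK d
  obtain ⟨β₄, hβ₄, H4⟩ := symmetrized_unique (d := d) (M := 2) (L := 4 * bigK d) (by norm_num) (by linarith)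
  have hβ₃ : (0 : ℝ) < 1 / (2 * bigK d ^ 5) := by positivity
  refine ⟨min (min β₁ β₂) (min (1 / (2 * bigK d ^ 5)) β₄), lt_min (lt_min hβ₁ hβ₂) (lt_min hβ₃ hβ₄),
    fun Λ hΛ β hβ s hs => ?_⟩
  have hb1 : |β| ≤ β₁ := hβ.trans ((min_le_left _ _).trans (min_le_left _ _))
  have hb2 : |β| ≤ β₂ := hβ.trans ((min_le_left _ _).trans (min_le_right _ _))
  have hb3 : |β| ≤ 1 / (2 * bigK d ^ 5) := hβ.trans ((min_le_right _ _).trans (min_le_left _ _))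
  have hb4 : |β| ≤ β₄ := hβ.trans ((min_le_right _ _).trans (min_le_right _ _))
  -- the 't Hooft limit along `Λ`
  set φ : LoopSeq d → ℝ := fun t => limUnder atTop (fun N : ℕ => phi N β (Λ N) t) with hφdef
  have hφ : ∀ t : LoopSeq d, IsLoopSeq t → Tendsto (fun N : ℕ => phi N β (Λ N) t) atTop (𝓝 (φ t)) :=
    fun t ht => tendsto_nhds_limUnder (H1 Λ hΛ β hb1 t ht)
  have hnil : IsLoopSeq ([] : LoopSeq d) := fun l hl => by simp at hl
  -- identification with the trajectory sum
  have hφT : ∀ t : LoopSeq d, IsLoopSeq t → φ t = ∑' X : Trajectory t, X.weight β := by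
    refine H4 β hb4 φ (fun t => ∑' X : Trajectory t, X.weight β) ?_ ?_ ?_ ?_ ?_
    · have h1 : φ [] = 1 :=
        tendsto_nhds_unique (hφ [] hnil) (by simpa only [phi_nil] using tendsto_const_nhds)
      rw [h1, trajectorySum_nil]
    · intro t ht
      have h : |φ t| ≤ 1 := le_of_tendsto' (hφ t ht).abs fun N => abs_phi_le_one _ _ _ _
      have h' : (1 : ℝ) ≤ (4 * bigK d) ^ t.len := one_le_pow₀ (by linarith)
      linarith
    · exact fun t ht => (trajectorySum_summable_and_abs_le hb3 ht).2
    · exact H2 Λ hΛ β hb2 φ hφ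
    · exact fun t ht htne => trajectorySum_equation hb3 ht htne
  refine ⟨(trajectorySum_summable_and_abs_le hb3 hs).1, ?_⟩
  rw [← hφT s hs]
  exact hφ s hs

/-! ## Consequences, now unconditional -/

/-- ★★★ **Corollary 3.2 (factorization of Wilson loops in the 't Hooft limit), unconditional**:
`lim_N ⟨W_{l₁}⋯W_{lₙ}⟩/Nⁿ = Πᵢ lim_N ⟨W_{lᵢ}⟩/N` for `|β| ≤ β₀(d)`. [cite: Chatterjee2019LargeN, Corollary 3.2] -/
theorem wilsonLoopFactorization_holds : WilsonLoopFactorization d :=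
  wilsonLoopFactorization_of_gaugeStringDuality (gaugeStringDuality_holds d)

/-- ★★★ **Corollary 3.5 (real analyticity at strong coupling), unconditional**:
`lim_N ⟨W_{l₁}⋯W_{lₙ}⟩/Nⁿ = Σ_k a_k(s) β^k`, absolutely convergent, for `|β| ≤ β₀(d)`. [cite: Chatterjee2019LargeN, Corollary 3.5] -/
theorem realAnalyticityStrongCoupling_holds : RealAnalyticityStrongCoupling d :=
  realAnalyticity_of_gaugeStringDuality (gaugeStringDuality_holds d)

/-- ★★ **Proposition 4.1 (the recursive algorithm for the coefficients `a_k(s)`), unconditional.**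
[cite: Chatterjee2019LargeN, Proposition 4.1] -/
theorem coeffRecursion_holds : CoeffRecursion d :=
  coeffRecursion_of_gaugeStringDuality_of_unsymmetrized (gaugeStringDuality_holds d)
    (SOMasterLoop.unsymmetrizedMasterLoopEquation_holds d)

variable {d}

/-- ★★ **Corollary 3.3, loopwise form, unconditional**: for each non-null loop `l`,
`lim_N |⟨W_l⟩|/N ≤ M(l) (|β|/β₀)^{area(l)}` for `|β| ≤ β₀(d)`. [cite: Chatterjee2019LargeN, Corollary 3.3 and §14] -/
theorem areaLawUpperBound_loopwise_holds (hd : 2 ≤ d) :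
    ∃ β₀ : ℝ, 0 < β₀ ∧
      ∀ Λ : ℕ → Finset (Literature.Probability.LatticeModels.Site d), IsExhaustion Λ →
        ∀ l : List (DEdge d), IsLoop l → l ≠ [] →
          ∃ M : ℝ, 0 ≤ M ∧ ∀ β : ℝ, |β| ≤ β₀ →
            ∃ L : ℝ,
              Tendsto (fun N : ℕ => |soExpect N β (Λ N) (wilsonLoopVar N l)| / N) atTop (𝓝 L) ∧
                L ≤ M * (|β| / β₀) ^ area l :=
  areaLawUpperBound_loopwise_of_gaugeStringDuality (gaugeStringDuality_holds d) hd

/-- ★★ **Corollary 3.3, perimeter × area form, unconditional**: `lim_N |⟨W_l⟩|/N ≤ C^{|l|} (C|β|)^{area(l)}` for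
`|β| ≤ β₁(d)`. [cite: Chatterjee2019LargeN, Corollary 3.3, §14, Lemma 10.1] -/
theorem areaLawUpperBound_perimeter_holds (hd : 2 ≤ d) :
    ∃ β₁ C : ℝ, 0 < β₁ ∧ 0 < C ∧
      ∀ Λ : ℕ → Finset (Literature.Probability.LatticeModels.Site d), IsExhaustion Λ →
        ∀ β : ℝ, |β| ≤ β₁ →
          ∀ l : List (DEdge d), IsLoop l → l ≠ [] →
            ∃ L : ℝ,
              Tendsto (fun N : ℕ => |soExpect N β (Λ N) (wilsonLoopVar N l)| / N) atTop (𝓝 L) ∧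
                L ≤ C ^ l.length * (C * |β|) ^ area l :=
  areaLawUpperBound_perimeter_of_gaugeStringDuality (gaugeStringDuality_holds d) hd

/-- ★ **Theorem 9.2, existence clause in closed form, unconditional**: for `|β| ≤ β₀(d)` the trajectory sum
`s ↦ Σ_{X ∈ 𝒳(s)} w_β(X)` is a class-`1` solution of the marked master loop equation of Theorem 9.1 (a cycle function,
`= 1` at `∅`, bounded by `1`). [cite: Chatterjee2019LargeN, Theorem 9.2 (existence), Theorem 3.1, Theorem 9.1] -/
theorem isMasterLoopSolution_trajectorySum_holds (hd : 2 ≤ d)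
    {Λ : ℕ → Finset (Literature.Probability.LatticeModels.Site d)} (hΛ : IsExhaustion Λ) :
    ∃ β₀ : ℝ, 0 < β₀ ∧ ∀ β : ℝ, |β| ≤ β₀ →
      IsMasterLoopSolution 1 β (fun s : LoopSeq d => ∑' X : Trajectory s, X.weight β) :=
  isMasterLoopSolution_trajectorySum (gaugeStringDuality_holds d)
    (SOMasterLoop.unsymmetrizedMasterLoopEquation_holds d) hd hΛ

end StringDuality

end Summit.QuantumFields.GaugeBoot

end
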